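import Mathlib
import HarnessLib
import Summits.NavierStokesRegularity.NavierStokesRegularity.Theorems.PoloidalWindowDoorLrcModEntireJetCertGaugeV
import Summits.NavierStokesRegularity.NavierStokesRegularity.Theorems.PoloidalWindowDoorLrcModEntireTHCertGauge

/-!
# Route `PoloidalWindowDoor`, item `LrcModEntire` (stmt-NavierStokesRegularity-20428) — the (TH) local datum WITH THE ROTATION–SCALING («RS») GAUGE:
# point-zero letters `u₂, u₀, u₁, ∂₀u₂` and the point-VALUE letter `∂₁u₂(p₀) = 1`, and the registered v4.3 stub `stub_localTHEmptyHypNUGRS` from a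
# gauged Cartesian certificate, BY NAME

Cell ns-regularity-ideate, seat ns-k2-port-2 g0 (second kernel porter under the LEAD of item 20428, ns-poloidal-K2-p3 g9, who registered twist_split v4.3 and
asked for this piece; `--supports stmt-NavierStokesRegularity-20428`).  The registered statement (twist_split v4.3, `stub_localTHEmptyHypNUGRS`) = v4.2's
`stub_localTHEmptyHypNUG` + two free normalisations AT `p₀`: `∂₀u₂(p₀) = 0`, `∂₁u₂(p₀) = 1` (K2-p2 g8 `…TwistingTHLocalNormalFormRS`: rotation about the
vertical + Navier–Stokes scaling).  With `…JetCertGaugeV` (point-value letters):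

* `gaugeZerosRS L = gaugeZeros L ++ [index of W 2 0 1 0 0]`, `gaugeValsRS L = [(index of W 2 0 0 1 0, 1)]`;
* `thLocalDatumZV` — from the hypotheses of `stub_localTHEmptyHypNUGRS` (the sign `μ(p₀) < 0` is not needed): a `LocalDatumZV` over the Cartesian letters with
  laws `thHyps L`, pins `thPins L ++ [pinNonUmbilic L]`, zero letters `[u₂, u₀, u₁, ∂₀u₂]` and the value letter `∂₁u₂ = 1`;
* `thZV_false_of_leaf` — the RS-gauged leaf after chunk folding (`LocalDatumZV.extendS`);
* `localTHEmptyHypNUGRS_of_leafZV` — **THE REGISTERED v4.3 STATEMENT, hypothesis for hypothesis, from one RS-gauged Cartesian leaf certificate** (no chunks;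
  with chunks use the two lemmas above).  Slice-letter version: `…THCertSliceGaugeUD8RS` (next file).

WHAT THIS IS NOT: not a claim about Navier–Stokes and not a certificate — plumbing. [folklore]
-/

noncomputable section

-- the summit and its single sub-problem share the name (CONVENTIONS §1), as in every Theorems file
set_option linter.dupNamespace false

namespace Summit.NavierStokesRegularity.NavierStokesRegularity.Theorems.PoloidalWindowDoorLrcModEntireTHCertGaugeRS

open _root_.Topology _root_.Filter Set Function
open scoped InnerProductSpace Laplacian
open Literature.Analysis.ValidatedNumerics
open Summit.NavierStokesRegularity.NavierStokesRegularity.Theorems.PoloidalWindowDoorLrcModEntireJetCertDefs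
open Summit.NavierStokesRegularity.NavierStokesRegularity.Theorems.PoloidalWindowDoorLrcModEntireJetCertTree
open Summit.NavierStokesRegularity.NavierStokesRegularity.Theorems.PoloidalWindowDoorLrcModEntireJetCertFast2
open Summit.NavierStokesRegularity.NavierStokesRegularity.Theorems.PoloidalWindowDoorLrcModEntireJetCertGauge
open Summit.NavierStokesRegularity.NavierStokesRegularity.Theorems.PoloidalWindowDoorLrcModEntireJetCertGaugeV
open Summit.NavierStokesRegularity.NavierStokesRegularity.Theorems.PoloidalWindowDoorLrcModEntireJetLetters
open Summit.NavierStokesRegularity.NavierStokesRegularity.Theorems.PoloidalWindowDoorLrcModEntireTHCertLetters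
open Summit.NavierStokesRegularity.NavierStokesRegularity.Theorems.PoloidalWindowDoorLrcModEntireTHCertDictionary
open Summit.NavierStokesRegularity.NavierStokesRegularity.Theorems.PoloidalWindowDoorLrcModEntireTHCert
open Summit.NavierStokesRegularity.NavierStokesRegularity.Theorems.PoloidalWindowDoorLrcModEntireTHCertSteady
open Summit.NavierStokesRegularity.NavierStokesRegularity.Theorems.PoloidalWindowDoorLrcModEntireTHCertGauge

/-- The point-zero letters of the RS gauge: the Galilean ones `[u₂, u₀, u₁]` and `∂₀u₂` (letter `W 2 0 1 0 0`). [folklore] -/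
def gaugeZerosRS (L : List THLetter) : List ℕ := gaugeZeros L ++ [L.idxOf (THLetter.W 2 0 1 0 0)]

/-- The point-value letter of the RS gauge: `∂₁u₂(p₀) = 1` (letter `W 2 0 0 1 0`). [folklore] -/
def gaugeValsRS (L : List THLetter) : List (ℕ × ℚ) := [(L.idxOf (THLetter.W 2 0 0 1 0), 1)]

/-- **The (TH) local datum with the non-umbilic pin and the RS gauge (zero AND value letters)**, from the hypotheses of the registered stub
`stub_localTHEmptyHypNUGRS` (twist_split v4.3). [folklore] -/
theorem thLocalDatumZV (L : List THLetter) (hL : lettersOK L = true)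
    {u : ℝ → EuclideanSpace ℝ (Fin 3) → EuclideanSpace ℝ (Fin 3)} {μ A : ℝ → ℝ → ℝ}
    {U : Set (ℝ × EuclideanSpace ℝ (Fin 3))} {p₀ : ℝ × EuclideanSpace ℝ (Fin 3)} (hU : IsOpen U) (hp₀ : p₀ ∈ U)
    (hu : AnalyticOnNhd ℝ (Function.uncurry u) U)
    (hμ : ∀ p ∈ U, AnalyticAt ℝ (Function.uncurry μ) (p.1, p.2 2)) (hA : ∀ p ∈ U, AnalyticAt ℝ (Function.uncurry A) (p.1, p.2 2))
    (hpol : ∀ p ∈ U, fderiv ℝ (u p.1) p.2 (EuclideanSpace.single 0 1) 1 = fderiv ℝ (u p.1) p.2 (EuclideanSpace.single 1 1) 0)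
    (hdiv : ∀ p ∈ U, fderiv ℝ (u p.1) p.2 (EuclideanSpace.single 0 1) 0 + fderiv ℝ (u p.1) p.2 (EuclideanSpace.single 1 1) 1 +
      fderiv ℝ (u p.1) p.2 (EuclideanSpace.single 2 1) 2 = 0)
    (hsh : ∀ p ∈ U, ∀ b : Fin 3, b ≠ 2 →
      fderiv ℝ (u p.1) p.2 (EuclideanSpace.single 2 1) b = μ p.1 (p.2 2) * fderiv ℝ (u p.1) p.2 (EuclideanSpace.single b 1) 2)
    (hE : ∀ p ∈ U,
      (1 - μ p.1 (p.2 2)) *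
          (deriv (fun s => u s p.2 2) p.1 + fderiv ℝ (fun y => u p.1 y 2) p.2 (u p.1 p.2) - Δ (fun y => u p.1 y 2) p.2) =
        A p.1 (p.2 2) + (deriv (fun s => μ s (p.2 2)) p.1 - deriv (deriv (μ p.1)) (p.2 2)) * u p.1 p.2 2
          + deriv (μ p.1) (p.2 2) / 2 * u p.1 p.2 2 ^ 2 - 2 * deriv (μ p.1) (p.2 2) * fderiv ℝ (u p.1) p.2 (EuclideanSpace.single 2 1) 2)
    (htw : fderiv ℝ (fun y => fderiv ℝ (u p₀.1) y (EuclideanSpace.single 2 1) 2) p₀.2 (EuclideanSpace.single 0 1) *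
            fderiv ℝ (u p₀.1) p₀.2 (EuclideanSpace.single 1 1) 2 -
          fderiv ℝ (fun y => fderiv ℝ (u p₀.1) y (EuclideanSpace.single 2 1) 2) p₀.2 (EuclideanSpace.single 1 1) *
            fderiv ℝ (u p₀.1) p₀.2 (EuclideanSpace.single 0 1) 2 ≠ 0)
    (hm0 : μ p₀.1 (p₀.2 2) ≠ 0) (hm1 : μ p₀.1 (p₀.2 2) ≠ 1) (hmz : deriv (μ p₀.1) (p₀.2 2) ≠ 0)
    (hNU : fderiv ℝ (u p₀.1) p₀.2 (EuclideanSpace.single 0 1) 0 ≠ fderiv ℝ (u p₀.1) p₀.2 (EuclideanSpace.single 1 1) 1 ∨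
      fderiv ℝ (u p₀.1) p₀.2 (EuclideanSpace.single 1 1) 0 ≠ 0)
    (hrest : u p₀.1 p₀.2 = 0)
    (hx0 : fderiv ℝ (u p₀.1) p₀.2 (EuclideanSpace.single 0 1) 2 = 0)
    (hy1 : fderiv ℝ (u p₀.1) p₀.2 (EuclideanSpace.single 1 1) 2 = 1) :
    LocalDatumZV (E := ℝ × EuclideanSpace ℝ (Fin 3)) L.length (tableOf L) (maskOf L) dirVec (thHyps L) (thPins L ++ [pinNonUmbilic L])
      (gaugeZerosRS L) (gaugeValsRS L) := by
  have m := fun ℓ (h : ℓ ∈ baseLetters) => mem_of_lettersOK hL h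
  -- built with the NAMED jet map `jetMapOf`, exactly as `…THCertGauge.thLocalDatumZ`, plus the two RS point facts
  have key : ∀ (ℓ : THLetter) (i : ℕ), ℓ ∈ L → i = L.idxOf ℓ → ∀ hlt : i < L.length,
      jetMapOf L u μ A p₀ ⟨i, hlt⟩ = letterFn u μ A ℓ p₀ := by
    intro ℓ i hmem hi hlt
    have hget : L[i]'hlt = ℓ := by subst hi; exact List.getElem_idxOf (List.idxOf_lt_length_iff.2 hmem)
    rw [jetMapOf, mkJet_apply]
    show letterFn u μ A (L[(⟨i, hlt⟩ : Fin L.length)]) p₀ = _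
    rw [show L[(⟨i, hlt⟩ : Fin L.length)] = L[i]'hlt from rfl, hget]
  refine ⟨U, p₀, jetMapOf L u μ A, hU, hp₀, fun _ hp => differentiableAt_jetMapOf hu hμ hA hp,
    fun j i hi _ hp => tables_jetMapOf hU hu hμ hA j i hi hp, thHyps_vanish hL hU hu hμ hpol hdiv hsh hE, ?_, ?_, ?_⟩
  · intro π hπ
    rcases List.mem_append.1 hπ with h | h
    · exact thPins_ne_zero hL hU hu hμ hp₀ htw hm0 hm1 hmz π h
    · simp only [List.mem_cons, List.mem_nil_iff, or_false] at h
      subst h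
      exact pinNonUmbilic_ne_zero hL hu hp₀ hNU
  · intro i hi hlt
    simp only [gaugeZerosRS, gaugeZeros, List.mem_append, List.mem_cons, List.mem_nil_iff, or_false] at hi
    rcases hi with (h | h | h) | h
    · rw [key _ _ (m _ (by simp [baseLetters])) h hlt, letterFn_W0, hrest]; rfl
    · rw [key _ _ (m _ (by simp [baseLetters])) h hlt, letterFn_W0, hrest]; rfl
    · rw [key _ _ (m _ (by simp [baseLetters])) h hlt, letterFn_W0, hrest]; rfl
    · rw [key _ _ (m _ (by simp [baseLetters])) h hlt, letterFn_Wx hu 2 hp₀, hx0]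
  · intro iv hiv hlt
    simp only [gaugeValsRS, List.mem_cons, List.mem_nil_iff, or_false] at hiv
    subst hiv
    show jetMapOf L u μ A p₀ ⟨L.idxOf (THLetter.W 2 0 0 1 0), hlt⟩ = ((1 : ℚ) : ℝ)
    rw [key _ _ (m _ (by simp [baseLetters])) rfl hlt, letterFn_Wy hu 2 hp₀, hy1]
    norm_num

/-- An RS-gauged leaf against the chunk-extended laws `thHyps L ++ Ts` closes the goal. [folklore] -/
theorem thZV_false_of_leaf (L : List THLetter) (Ts : List QMvPoly) (steps : List (List (QMvPoly × ℕ × List ℕ))) (k : ℕ) (e : List ℕ)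
    (hcheck : leafCheckZV L.length (tableOf L) (maskOf L) (thHyps L ++ Ts) (thPins L ++ [pinNonUmbilic L]) (gaugeZerosRS L) (gaugeValsRS L)
      steps k e = true)
    (hdat : LocalDatumZV (E := ℝ × EuclideanSpace ℝ (Fin 3)) L.length (tableOf L) (maskOf L) dirVec (thHyps L ++ Ts)
      (thPins L ++ [pinNonUmbilic L]) (gaugeZerosRS L) (gaugeValsRS L)) : False :=
  LocalDatumZV.false_of_leaf hdat hcheck

/-- **THE REGISTERED STUB `stub_localTHEmptyHypNUGRS` (twist_split v4.3, VERBATIM) FROM ONE RS-GAUGED CARTESIAN LEAF CERTIFICATE** (no chunks):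
the derivation `steps` from the five base laws produces as law `k` a polynomial that equals `twist^e₀·μ^e₁·(μ−1)^e₂·μ_z^e₃·Π_NU^e₄` up to terms that
vanish at `p₀` after the substitution `∂₁u₂ ↦ 1` (i.e. terms containing `u₂(p₀)`, `u₀(p₀)`, `u₁(p₀)` or `∂₀u₂(p₀)`). [folklore] -/
theorem localTHEmptyHypNUGRS_of_leafZV (L : List THLetter) (hL : lettersOK L = true) (steps : List (List (QMvPoly × ℕ × List ℕ))) (k : ℕ)
    (e : List ℕ)
    (hcheck : leafCheckZV L.length (tableOf L) (maskOf L) (thHyps L) (thPins L ++ [pinNonUmbilic L]) (gaugeZerosRS L) (gaugeValsRS L)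
      steps k e = true) :
    ∀ (u : ℝ → EuclideanSpace ℝ (Fin 3) → EuclideanSpace ℝ (Fin 3)) (μ A : ℝ → ℝ → ℝ)
      (U : Set (ℝ × EuclideanSpace ℝ (Fin 3))) (p₀ : ℝ × EuclideanSpace ℝ (Fin 3)),
      IsOpen U → p₀ ∈ U →
      AnalyticOnNhd ℝ (Function.uncurry u) U →
      (∀ p ∈ U, AnalyticAt ℝ (Function.uncurry μ) (p.1, p.2 2)) →
      (∀ p ∈ U, AnalyticAt ℝ (Function.uncurry A) (p.1, p.2 2)) →
      (∀ p ∈ U, fderiv ℝ (u p.1) p.2 (EuclideanSpace.single 0 1) 1 = fderiv ℝ (u p.1) p.2 (EuclideanSpace.single 1 1) 0) →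
      (∀ p ∈ U, fderiv ℝ (u p.1) p.2 (EuclideanSpace.single 0 1) 0 + fderiv ℝ (u p.1) p.2 (EuclideanSpace.single 1 1) 1 +
        fderiv ℝ (u p.1) p.2 (EuclideanSpace.single 2 1) 2 = 0) →
      (∀ p ∈ U, ∀ b : Fin 3, b ≠ 2 →
        fderiv ℝ (u p.1) p.2 (EuclideanSpace.single 2 1) b =
          μ p.1 (p.2 2) * fderiv ℝ (u p.1) p.2 (EuclideanSpace.single b 1) 2) →
      (∀ p ∈ U,
        (1 - μ p.1 (p.2 2)) *
            (deriv (fun s => u s p.2 2) p.1 + fderiv ℝ (fun y => u p.1 y 2) p.2 (u p.1 p.2)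
              - Δ (fun y => u p.1 y 2) p.2) =
          A p.1 (p.2 2) + (deriv (fun s => μ s (p.2 2)) p.1 - deriv (deriv (μ p.1)) (p.2 2)) * u p.1 p.2 2
            + deriv (μ p.1) (p.2 2) / 2 * u p.1 p.2 2 ^ 2
            - 2 * deriv (μ p.1) (p.2 2) * fderiv ℝ (u p.1) p.2 (EuclideanSpace.single 2 1) 2) →
      fderiv ℝ (fun y => fderiv ℝ (u p₀.1) y (EuclideanSpace.single 2 1) 2) p₀.2 (EuclideanSpace.single 0 1) *
            fderiv ℝ (u p₀.1) p₀.2 (EuclideanSpace.single 1 1) 2 -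
          fderiv ℝ (fun y => fderiv ℝ (u p₀.1) y (EuclideanSpace.single 2 1) 2) p₀.2 (EuclideanSpace.single 1 1) *
            fderiv ℝ (u p₀.1) p₀.2 (EuclideanSpace.single 0 1) 2 ≠ 0 →
      μ p₀.1 (p₀.2 2) ≠ 0 → μ p₀.1 (p₀.2 2) ≠ 1 → deriv (μ p₀.1) (p₀.2 2) ≠ 0 →
      μ p₀.1 (p₀.2 2) < 0 →
      (fderiv ℝ (u p₀.1) p₀.2 (EuclideanSpace.single 0 1) 0 ≠ fderiv ℝ (u p₀.1) p₀.2 (EuclideanSpace.single 1 1) 1 ∨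
        fderiv ℝ (u p₀.1) p₀.2 (EuclideanSpace.single 1 1) 0 ≠ 0) →
      u p₀.1 p₀.2 = 0 →
      fderiv ℝ (u p₀.1) p₀.2 (EuclideanSpace.single 0 1) 2 = 0 →
      fderiv ℝ (u p₀.1) p₀.2 (EuclideanSpace.single 1 1) 2 = 1 → False := by
  intro u μ A U p₀ hU hp₀ hu hμ hA hpol hdiv hsh hE htw hm0 hm1 hmz _hneg hNU hrest hx0 hy1
  exact LocalDatumZV.false_of_leaf (thLocalDatumZV L hL hU hp₀ hu hμ hA hpol hdiv hsh hE htw hm0 hm1 hmz hNU hrest hx0 hy1) hcheck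

end Summit.NavierStokesRegularity.NavierStokesRegularity.Theorems.PoloidalWindowDoorLrcModEntireTHCertGaugeRS

end
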